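import Mathlib
import Summits.Ventures.HodgeRepro2.Tier7.Line3.Defs
import Summits.Ventures.HodgeRepro2.Tier7.Line1.FDConverse
import Summits.Ventures.HodgeRepro2.Tier7.Line1.RtfBridge
import Summits.Ventures.HodgeRepro2.Tier7.Common.TwoTorus

/-!
# Tier 7 — LINE 1: the `L²`-orthogonal projection onto a finite-dimensional `W ⊆ H^{2,0}`, defined on ALL of `HX`
(`Line1/ProjHX.lean`; t7-L1-p5, gen 1)

Product of t7-L1-p5 (STATUS l. 14868, the TARGET line of record): L3's piece P1 (`Line3/LEMMAS.md`:
`rtfConclusion_of_finiteDimensional`) in its RETRACTION-FREE form, and the bridge `CommonIrred D → Line3.RtfConclusion D`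
of `Line1/RtfBridge.lean` (t7-L1-p3, p664689) WITHOUT its displayed projector `P`.

THE POINT. `RtfBridge` needed a Hecke-equivariant retraction `P : HX → H^{1,0} ∧ H^{1,0}` because t7-L1-p5's projection
`FD.projLin` (FDConverse.lean) is only defined on `H^{1,0} ∧ H^{1,0}`. But the `L²`-orthogonal projection onto a
FINITE-DIMENSIONAL `U ⊆ H^{1,0} ∧ H^{1,0}` is definable on ALL of `HX` and is Hecke-equivariant there, because the
frozen fields make `L2` a `G`-invariant pairing on all of `HX` (`intX_act` + `act_mul` + `bar_act` = `FD.L2_act`, no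
`H^{2,0}` restriction) and a positive definite hermitian form on `U` (`hr_pos`, `comm_H20`, `intX_bar`):
`projHX x := Σ_i L2 x (b i) • b i` for an `L²`-orthonormal basis `b` of `U` (Mathlib's `stdOrthonormalBasis` of the
finite-dimensional inner product space `(U, l2CoreOn)`), characterised by `projHX x ∈ U` and
`∀ u ∈ U, L2 (x - projHX x) u = 0` for EVERY `x ∈ HX` (`L2_sub_projHX`); equivariance (`projHX_act`): the
difference `d := projHX (g • x) - g • projHX x` lies in `U` and is `L²`-orthogonal to `U` (invariance of `L2`),
so `L2 d d = 0`, so `d = 0` (Hodge–Riemann). A `G`-invariant form non-degenerate on `U` splits every extension of `U`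
inside `HX` equivariantly (`HX = U ⊕ U^⊥`): this is why no «non-split extension of `W` inside `HX`» can separate
P1 from the bridge under the frozen fields (t7-L1-p3 l. 14858 (2), answered in the kernel).

CONTENT (all PROVED, sorry-free, axioms of every declaration: propext / Classical.choice / Quot.sound):
* §1 `bar_sum`, `L2_sum_left`, `L2_sum_right` (finite sums);
* §2 `l2CoreOn U hU`: the `L²` inner product on any `U ⊆ H^{1,0} ∧ H^{1,0}` (t7-L1-p5's `l2Core`, relativised);
* §3 `onb` (an `L²`-orthonormal basis of a finite-dimensional `U`), `L2_onb`, `onb_expand`; `projHX U hU : HX →ₗ[ℂ] HX`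
  with `projHX_mem`, `L2_projHX`, `L2_sub_projHX`, `projHX_eq_self`, `projHX_eq_zero`, `projHX_act`;
* §4 `exists_heckeProjector_of_finiteDimensional`: on finite-dimensional data the displayed projector `P` of
  `RtfBridge` (`hPmem`, `hPid`, `hPact`) EXISTS — it is `projHX` onto `H^{1,0} ∧ H^{1,0}` itself;
* §5 `rtfConclusion_of_commonIrred_noProj (ho : OrthDistinct D) (hfin) : CommonIrred D → Line3.RtfConclusion D`
  (= `RtfBridge.rtfConclusion_of_commonIrred` with `P, hPmem, hPid, hPact` DELETED; `comp := projHX` onto the common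
  irreducible; the rest is t7-L1-p3's proof verbatim), `rtfConclusion_iff_commonIrred_noProj`,
  `rtfConclusion_iff_conclusion_noProj`; the `hfin`-only forms (`OrthDistinct` is then a theorem,
  `orthDistinct_of_irred_finiteDimensional`): `rtfConclusion_of_commonIrred_of_irred_finiteDimensional`,
  `rtfConclusion_iff_conclusion_of_irred_finiteDimensional`;
* §6 P1 EXACTLY as t7-plan-3 stated it: `rtfConclusion_of_finiteDimensional (hfin : FiniteDimensional ℂ (H10 * H10))
  (hC : ∃ g, L2 (fOmegaS g) (fOmegaSbar g) ≠ 0) : Line3.RtfConclusion D`, and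
  `rtfConclusion_iff_conclusion_of_finiteDimensional`.

RECORD: on every datum whose Hecke-irreducible subspaces of `H^{1,0} ∧ H^{1,0}` are finite-dimensional (a fortiori on
every datum with `FiniteDimensional ℂ (H10 * H10)`), `Line3.RtfConclusion D ↔ CommonIrred D ↔ ∃ g, L2 (fOmegaS g)
(fOmegaSbar g) ≠ 0` with NO projector hypothesis and NO displayed `OrthDistinct` (both are theorems there). Nothing
here produces a non-vanishing: the file converts one residual into the other on such data.
Imports: `Mathlib` + `Line3.Defs` + `Line1.FDConverse` + `Line1.RtfBridge` + `Common.TwoTorus`.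
§8(d): uses an L-value-free non-vanishing device: NO.
-/

namespace Summit.Ventures.HodgeRepro2.Tier7.Line1.FD

open Summit.Ventures.HodgeRepro2.Tier7

noncomputable section

variable {HX : Type} [Ring HX] [Algebra ℂ HX] {G : Type} [Group G] [MulAction G HX]
  (S : SurfaceShadow HX G)

/-! ## 1. Finite sums through `bar` and `L2` -/

/-- `bar` commutes with finite sums (`bar_add`, `bar_zero`) -/
theorem bar_sum {ι : Type} (s : Finset ι) (f : ι → HX) :
    S.bar (∑ i ∈ s, f i) = ∑ i ∈ s, S.bar (f i) := by
  classical
  refine Finset.induction_on s ?_ ?_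
  · rw [Finset.sum_empty, Finset.sum_empty]
    exact bar_zero S
  · intro a t ha ih
    rw [Finset.sum_insert ha, Finset.sum_insert ha, S.bar_add, ih]

/-- `L2` is additive in the first variable over finite sums -/
theorem L2_sum_left {ι : Type} (s : Finset ι) (f : ι → HX) (u : HX) :
    S.L2 (∑ i ∈ s, f i) u = ∑ i ∈ s, S.L2 (f i) u := by
  unfold SurfaceShadow.L2
  rw [Finset.sum_mul, map_sum]

/-- `L2` is additive in the second variable over finite sums -/
theorem L2_sum_right {ι : Type} (s : Finset ι) (a : HX) (f : ι → HX) :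
    S.L2 a (∑ i ∈ s, f i) = ∑ i ∈ s, S.L2 a (f i) := by
  unfold SurfaceShadow.L2
  rw [bar_sum, Finset.mul_sum, map_sum]

/-! ## 2. The `L²` inner product on a subspace `U ⊆ H^{1,0} ∧ H^{1,0}` -/

/-- The `L²` pairing as an inner product on any `U ⊆ H^{1,0} ∧ H^{1,0}`, in Mathlib's convention (conjugate-linear in
the FIRST variable): `⟪x, y⟫ := ⟨y, x⟩_{L²} = ∫_X y ∧ x̄`. Hermitian by `L2_conj`, positive definite by
Hodge–Riemann (`hr_pos`). -/
abbrev l2CoreOn (U : Submodule ℂ HX) (hU : U ≤ S.H10 * S.H10) : InnerProductSpace.Core ℂ ↥U where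
  inner x y := S.L2 (y : HX) (x : HX)
  conj_inner_symm x y := L2_conj S (x : HX) (y : HX) (hU x.2) (hU y.2)
  re_inner_nonneg x := by
    show 0 ≤ RCLike.re (S.L2 (x : HX) (x : HX))
    rw [RCLike.re_to_complex]
    by_cases hx : (x : HX) = 0
    · rw [hx, L2_zero_left]
      simp
    · exact le_of_lt (S.hr_pos (x : HX) (hU x.2) hx)
  add_left x y z := by
    show S.L2 (z : HX) ((x : HX) + (y : HX)) = S.L2 (z : HX) (x : HX) + S.L2 (z : HX) (y : HX)
    exact L2_add_right S _ _ _
  smul_left x y r := by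
    show S.L2 (y : HX) (r • (x : HX)) = (starRingEnd ℂ) r * S.L2 (y : HX) (x : HX)
    exact L2_smul_right S _ _ _
  definite x hx := by
    have : (x : HX) = 0 := eq_zero_of_L2_self_eq_zero S (x : HX) (hU x.2) hx
    exact Subtype.ext this

/-- the normed group structure on `U` induced by the `L²` inner product -/
abbrev l2Normed (U : Submodule ℂ HX) (hU : U ≤ S.H10 * S.H10) : NormedAddCommGroup ↥U :=
  @InnerProductSpace.Core.toNormedAddCommGroup ℂ ↥U _ _ _ (l2CoreOn S U hU)

/-- the inner product space structure on `U` induced by the `L²` inner product -/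
abbrev l2IPS (U : Submodule ℂ HX) (hU : U ≤ S.H10 * S.H10) :
    letI := l2Normed S U hU; InnerProductSpace ℂ ↥U :=
  letI := l2Normed S U hU; InnerProductSpace.ofCore (l2CoreOn S U hU).toCore

/-! ## 3. The projection onto a finite-dimensional `U ⊆ H^{1,0} ∧ H^{1,0}`, on ALL of `HX` -/

section Proj

variable (U : Submodule ℂ HX) (hU : U ≤ S.H10 * S.H10) [FiniteDimensional ℂ U]

/-- an `L²`-orthonormal basis of the finite-dimensional `U` (Mathlib's `stdOrthonormalBasis` for `l2CoreOn`) -/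
def onb : letI := l2Normed S U hU; letI := l2IPS S U hU;
    OrthonormalBasis (Fin (Module.finrank ℂ ↥U)) ℂ ↥U :=
  letI := l2Normed S U hU; letI := l2IPS S U hU; stdOrthonormalBasis ℂ ↥U

/-- orthonormality, in the `L2` vocabulary: `⟨b j, b i⟩_{L²} = δ_{ij}` -/
theorem L2_onb (i j : Fin (Module.finrank ℂ ↥U)) :
    S.L2 ((onb S U hU j : ↥U) : HX) ((onb S U hU i : ↥U) : HX) = if i = j then (1 : ℂ) else 0 := by
  letI := l2Normed S U hU
  letI := l2IPS S U hU
  have h := orthonormal_iff_ite.mp (onb S U hU).orthonormal i j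
  exact h

/-- expansion of `u ∈ U` in the orthonormal basis: `u = Σ_i ⟨u, b i⟩_{L²} • b i` -/
theorem onb_expand (u : ↥U) :
    (u : HX) = ∑ i, S.L2 (u : HX) ((onb S U hU i : ↥U) : HX) • ((onb S U hU i : ↥U) : HX) := by
  letI := l2Normed S U hU
  letI := l2IPS S U hU
  have h : (∑ i, S.L2 (u : HX) ((onb S U hU i : ↥U) : HX) • onb S U hU i : ↥U) = u :=
    (onb S U hU).sum_repr' u
  have h' := congrArg Subtype.val h
  rw [Submodule.coe_sum] at h'
  simp only [Submodule.coe_smul] at h'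
  exact h'.symm

/-- **THE PROJECTION ON ALL OF `HX`**: `projHX x := Σ_i ⟨x, b i⟩_{L²} • b i` for an `L²`-orthonormal basis `b` of the
finite-dimensional `U ⊆ H^{1,0} ∧ H^{1,0}` — ℂ-linear in `x ∈ HX` (linearity of `L2` in its first variable) -/
def projHX : HX →ₗ[ℂ] HX where
  toFun x := ∑ i, S.L2 x ((onb S U hU i : ↥U) : HX) • ((onb S U hU i : ↥U) : HX)
  map_add' x y := by
    simp only [L2_add_left, add_smul, Finset.sum_add_distrib]
  map_smul' c x := by
    simp only [L2_smul_left, RingHom.id_apply, Finset.smul_sum, smul_smul]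

/-- (PROVED) unfolding -/
theorem projHX_apply (x : HX) :
    projHX S U hU x = ∑ i, S.L2 x ((onb S U hU i : ↥U) : HX) • ((onb S U hU i : ↥U) : HX) := rfl

/-- (PROVED) the projection takes values in `U` -/
theorem projHX_mem (x : HX) : projHX S U hU x ∈ U := by
  rw [projHX_apply]
  exact Submodule.sum_mem _ fun i _ => Submodule.smul_mem _ _ (onb S U hU i).2

/-- (PROVED) against a basis vector the projection pairs like `x`: `⟨projHX x, b j⟩ = ⟨x, b j⟩` (orthonormality) -/
theorem L2_projHX_onb (x : HX) (j : Fin (Module.finrank ℂ ↥U)) :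
    S.L2 (projHX S U hU x) ((onb S U hU j : ↥U) : HX) = S.L2 x ((onb S U hU j : ↥U) : HX) := by
  rw [projHX_apply, L2_sum_left]
  simp only [L2_smul_left, L2_onb, mul_ite, mul_one, mul_zero, Finset.sum_ite_eq, Finset.mem_univ,
    if_true]

/-- (PROVED) **THE CHARACTERISATION**, for EVERY `x ∈ HX`: `⟨projHX x, u⟩_{L²} = ⟨x, u⟩_{L²}` for all `u ∈ U`
(expand `u` in the orthonormal basis, antilinearity of `L2` in its second variable, `L2_projHX_onb`) -/
theorem L2_projHX (x : HX) (u : HX) (hu : u ∈ U) :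
    S.L2 (projHX S U hU x) u = S.L2 x u := by
  have e : u = ∑ i, S.L2 u ((onb S U hU i : ↥U) : HX) • ((onb S U hU i : ↥U) : HX) :=
    onb_expand S U hU ⟨u, hu⟩
  rw [e, L2_sum_right, L2_sum_right]
  simp only [L2_smul_right, L2_projHX_onb]

/-- (PROVED) the remainder `x - projHX x` is `L²`-orthogonal to `U`, for EVERY `x ∈ HX` -/
theorem L2_sub_projHX (x : HX) (u : HX) (hu : u ∈ U) :
    S.L2 (x - projHX S U hU x) u = 0 := by
  rw [L2_sub_left, L2_projHX S U hU x u hu, sub_self]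

/-- (PROVED) the projection is the identity on `U` (the remainder lies in `U` and is orthogonal to `U`, so it
vanishes by Hodge–Riemann) -/
theorem projHX_eq_self (x : HX) (hx : x ∈ U) : projHX S U hU x = x := by
  have hd : x - projHX S U hU x ∈ U := Submodule.sub_mem _ hx (projHX_mem S U hU x)
  have h0 : S.L2 (x - projHX S U hU x) (x - projHX S U hU x) = 0 := L2_sub_projHX S U hU x _ hd
  have h := eq_zero_of_L2_self_eq_zero S _ (hU hd) h0
  exact (sub_eq_zero.mp h).symm

/-- (PROVED) the projection vanishes on a vector `L²`-orthogonal to `U` -/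
theorem projHX_eq_zero (x : HX) (h : ∀ u ∈ U, S.L2 x u = 0) : projHX S U hU x = 0 := by
  rw [projHX_apply]
  exact Finset.sum_eq_zero fun i _ => by rw [h _ (onb S U hU i).2, zero_smul]

/-- (PROVED) **HECKE EQUIVARIANCE ON ALL OF `HX`** for a Hecke-stable `U`: `projHX (g • x) = g • projHX x`.
The difference `d` lies in `U`; for `u ∈ U`, `⟨projHX (g • x), u⟩ = ⟨g • x, u⟩ = ⟨x, g⁻¹ • u⟩ = ⟨projHX x, g⁻¹ • u⟩
= ⟨g • projHX x, u⟩` by the characterisation and the `G`-invariance of `L2` on `HX` (`L2_act`); so `d` is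
`L²`-orthogonal to `U`, hence `⟨d, d⟩ = 0`, hence `d = 0` (Hodge–Riemann). -/
theorem projHX_act (hUs : HeckeStable G U) (g : G) (x : HX) :
    projHX S U hU (g • x) = g • projHX S U hU x := by
  have hd : projHX S U hU (g • x) - g • projHX S U hU x ∈ U :=
    Submodule.sub_mem _ (projHX_mem S U hU _) (hUs g _ (projHX_mem S U hU x))
  have horth : ∀ u ∈ U, S.L2 (projHX S U hU (g • x) - g • projHX S U hU x) u = 0 := by
    intro u hu
    rw [L2_sub_left, L2_projHX S U hU _ u hu]
    have h1 : S.L2 (g • x) u = S.L2 x (g⁻¹ • u) := by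
      conv_lhs => rw [← smul_inv_smul g u]
      rw [L2_act]
    have h2 : S.L2 (g • projHX S U hU x) u = S.L2 (projHX S U hU x) (g⁻¹ • u) := by
      conv_lhs => rw [← smul_inv_smul g u]
      rw [L2_act]
    rw [h1, h2, L2_projHX S U hU x _ (hUs g⁻¹ u hu), sub_self]
  have h0 := horth _ hd
  have h := eq_zero_of_L2_self_eq_zero S _ (hU hd) h0
  exact sub_eq_zero.mp h

end Proj

/-! ## 4. On finite-dimensional data the displayed projector of `RtfBridge` EXISTS -/

/-- (PROVED) **the retraction `P` of `Line1/RtfBridge.lean` is a THEOREM on finite-dimensional data**: if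
`H^{1,0} ∧ H^{1,0}` is finite-dimensional, there is a ℂ-linear `P : HX → HX` with values in `H^{1,0} ∧ H^{1,0}`, the
identity on it, and Hecke-equivariant on all of `HX` — namely `projHX` onto `H^{1,0} ∧ H^{1,0}` itself. -/
theorem exists_heckeProjector_of_finiteDimensional (hfd : FiniteDimensional ℂ (S.H10 * S.H10)) :
    ∃ P : HX →ₗ[ℂ] HX, (∀ x, P x ∈ S.H10 * S.H10) ∧ (∀ x ∈ S.H10 * S.H10, P x = x) ∧
      ∀ (g : G) (x : HX), P (g • x) = g • P x := by
  haveI := hfd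
  exact ⟨projHX S (S.H10 * S.H10) le_rfl, projHX_mem S _ _, projHX_eq_self S _ _,
    projHX_act S _ _ (H20_heckeStable S)⟩

end

end Summit.Ventures.HodgeRepro2.Tier7.Line1.FD

/-! ## 5. The bridge `CommonIrred D → Line3.RtfConclusion D` WITHOUT a displayed projector -/

namespace Summit.Ventures.HodgeRepro2.Tier7.Line1

open Summit.Ventures.HodgeRepro2.Tier7

section

variable {K : Type} [Field K] [NumberField K] {E' : Type} [Field E'] [NumberField E']
  {V : Type} [AddCommGroup V] [Module E' V] {HX : Type} [Ring HX] [Algebra ℂ HX]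
  {G : Type} [Group G] [MulAction G HX] (D : PeriodDatum K E' V HX G)

/-- **(PROVED) `CommonIrred D → Line3.RtfConclusion D`** on data with the displayed `OrthDistinct` and
finite-dimensional Hecke-irreducibles — `RtfBridge.rtfConclusion_of_commonIrred` (t7-L1-p3) with its projector
hypotheses `P`, `hPmem`, `hPid`, `hPact` DELETED: `comp := FD.projHX` onto the common irreducible `W`, defined and
Hecke-equivariant on all of `HX`; `comp_preserves` as in `RtfBridge` (a Hecke-stable `U ⊆ H^{2,0}` either contains `W`
or is `L²`-orthogonal to it, `le_of_L2_ne_zero`); the two non-vanishing clauses because `comp` is the identity on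
`W ≠ ⊥ ⊆ P_A` (resp. `P_B`), so it cannot kill every generator. -/
theorem rtfConclusion_of_commonIrred_noProj (ho : OrthDistinct D)
    (hfin : ∀ W : Submodule ℂ HX, HeckeIrred G W → W ≤ D.S.H10 * D.S.H10 → FiniteDimensional ℂ W)
    (hc : CommonIrred D) : Line3.RtfConclusion D := by
  have hinf := (commonIrred_iff_inf_ne_bot D).mp hc
  obtain ⟨W, hWle, hW⟩ := exists_irred_le_of_stable D (inf_le_left.trans (prodModS_le D))
    (heckeStable_inf (prodModS_stable D) (prodModSbar_stable D)) hinf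
  have hWH : W ≤ D.S.H10 * D.S.H10 := hWle.trans (inf_le_left.trans (prodModS_le D))
  haveI : FiniteDimensional ℂ W := hfin W hW hWH
  let comp : HX →ₗ[ℂ] HX := FD.projHX D.S W hWH
  let sw : Line3.SeesawData D :=
    { Rep := Unit
      Θ := fun _ => W
      comp := fun _ => comp
      Θ_le := fun _ => hWH
      Θ_irred := fun _ _ => hW
      comp_mem := fun _ x => FD.projHX_mem D.S W hWH x
      comp_act := fun _ g x => FD.projHX_act D.S W hWH hW.2.1 g x
      comp_preserves := fun _ U hU hUs x hx => by
        by_cases hWU : W ≤ U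
        · exact hWU (FD.projHX_mem D.S W hWH x)
        · have horth : ∀ f ∈ W, D.S.L2 x f = 0 := by
            intro f hf
            by_contra hne
            exact hWU (le_of_L2_ne_zero D ho hW hWH hU hUs hx hf hne)
          show FD.projHX D.S W hWH x ∈ U
          rw [FD.projHX_eq_zero D.S W hWH x horth]
          exact Submodule.zero_mem _ }
  have hgen : ∀ F : (Fin 4 → G) → HX, W ≤ Submodule.span ℂ (Set.range F) →
      ∃ g : Fin 4 → G, comp (F g) ≠ 0 := by
    intro F hWF
    by_contra hall
    have hall' : ∀ g : Fin 4 → G, comp (F g) = 0 := fun g => by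
      by_contra h
      exact hall ⟨g, h⟩
    have hker : Submodule.span ℂ (Set.range F) ≤ LinearMap.ker comp := by
      rw [Submodule.span_le]
      rintro _ ⟨g, rfl⟩
      exact LinearMap.mem_ker.mpr (hall' g)
    obtain ⟨w, hw, hw0⟩ := Submodule.exists_mem_ne_zero_of_ne_bot hW.1
    have h1 : comp w = 0 := LinearMap.mem_ker.mp (hker (hWF hw))
    have h2 : comp w = w := FD.projHX_eq_self D.S W hWH w hw
    exact hw0 (h2.symm.trans h1)
  exact ⟨sw, (), hgen D.fOmegaS (hWle.trans inf_le_left), hgen D.fOmegaSbar (hWle.trans inf_le_right)⟩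

/-- (PROVED) on such data the two residuals of the tier COINCIDE, with no projector hypothesis
(⇒ is plan-2's `Common.commonIrred_of_rtfConclusion`) -/
theorem rtfConclusion_iff_commonIrred_noProj (ho : OrthDistinct D)
    (hfin : ∀ W : Submodule ℂ HX, HeckeIrred G W → W ≤ D.S.H10 * D.S.H10 → FiniteDimensional ℂ W) :
    Line3.RtfConclusion D ↔ CommonIrred D :=
  ⟨Common.commonIrred_of_rtfConclusion D, rtfConclusion_of_commonIrred_noProj D ho hfin⟩

/-- (PROVED) and both are the conclusion (P) for the datum in its common-vector form, with no projector hypothesis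
(`commonIrred_iff_conclusion_of_orth`, t7-L1-p5) -/
theorem rtfConclusion_iff_conclusion_noProj (ho : OrthDistinct D)
    (hfin : ∀ W : Submodule ℂ HX, HeckeIrred G W → W ≤ D.S.H10 * D.S.H10 → FiniteDimensional ℂ W) :
    Line3.RtfConclusion D ↔ ∃ g : Fin 4 → G, D.S.L2 (D.fOmegaS g) (D.fOmegaSbar g) ≠ 0 :=
  (rtfConclusion_iff_commonIrred_noProj D ho hfin).trans (commonIrred_iff_conclusion_of_orth D ho)

/-- (PROVED) the `hfin`-only form: on data whose Hecke-irreducible subspaces of `H^{1,0} ∧ H^{1,0}` are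
finite-dimensional, `OrthDistinct` is a theorem (`orthDistinct_of_irred_finiteDimensional`, (H10)), so the bridge
needs NO displayed hypothesis beyond the finiteness -/
theorem rtfConclusion_of_commonIrred_of_irred_finiteDimensional
    (hfin : ∀ W : Submodule ℂ HX, HeckeIrred G W → W ≤ D.S.H10 * D.S.H10 → FiniteDimensional ℂ W)
    (hc : CommonIrred D) : Line3.RtfConclusion D :=
  rtfConclusion_of_commonIrred_noProj D (orthDistinct_of_irred_finiteDimensional D hfin) hfin hc

/-- (PROVED) the `hfin`-only equivalence `Line3.RtfConclusion D ↔ C(D)` -/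
theorem rtfConclusion_iff_conclusion_of_irred_finiteDimensional
    (hfin : ∀ W : Submodule ℂ HX, HeckeIrred G W → W ≤ D.S.H10 * D.S.H10 → FiniteDimensional ℂ W) :
    Line3.RtfConclusion D ↔ ∃ g : Fin 4 → G, D.S.L2 (D.fOmegaS g) (D.fOmegaSbar g) ≠ 0 :=
  rtfConclusion_iff_conclusion_noProj D (orthDistinct_of_irred_finiteDimensional D hfin) hfin

/-! ## 6. L3's piece P1, exactly as stated by t7-plan-3 (Line3/LEMMAS.md) -/

/-- **(PROVED) P1** — `rtfConclusion_of_finiteDimensional`, t7-plan-3's statement verbatim: over finite-dimensional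
data the conclusion `∃ g, ⟨f^*Ω_s, f^*Ω_{s̄}⟩ ≠ 0` gives `Line3.RtfConclusion D` with NO retraction displayed
(`commonIrred_of_finiteDimensional` + the retraction-free bridge). -/
theorem rtfConclusion_of_finiteDimensional (hfin : FiniteDimensional ℂ (D.S.H10 * D.S.H10))
    (hC : ∃ g : Fin 4 → G, D.S.L2 (D.fOmegaS g) (D.fOmegaSbar g) ≠ 0) : Line3.RtfConclusion D :=
  rtfConclusion_of_commonIrred_noProj D (orthDistinct_of_finiteDimensional D hfin)
    (fun _ _ hWle => Submodule.finiteDimensional_of_le hWle) (commonIrred_of_finiteDimensional D hfin hC)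

/-- (PROVED) on finite-dimensional data, `Line3.RtfConclusion D ↔ C(D)` with no further hypothesis
(⇒ plan-2's `Common.commonIrred_of_rtfConclusion` + `target_of_common_irred`) -/
theorem rtfConclusion_iff_conclusion_of_finiteDimensional (hfin : FiniteDimensional ℂ (D.S.H10 * D.S.H10)) :
    Line3.RtfConclusion D ↔ ∃ g : Fin 4 → G, D.S.L2 (D.fOmegaS g) (D.fOmegaSbar g) ≠ 0 :=
  ⟨fun h => target_of_common_irred D (Common.commonIrred_of_rtfConclusion D h),
    rtfConclusion_of_finiteDimensional D hfin⟩

end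

end Summit.Ventures.HodgeRepro2.Tier7.Line1
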